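import Summits.Schanuel.Schanuel.Theorems.RootDecomp1KCubicDescent01

/-!
# RootDecomp1KCubicDescent — lens 1, generation 59, NODE 20 «3-DESCENT ON THE K-LINE» (Chevalley–Weil through the ℚ-rational 3-torsion μ₃-cover, Runge function w + 2 upstairs; RULE K-R50 (iii) payable clause; CLAIM L2763, PRICE L2766, K-R51) — continuation (RootDecomp1KCubicDescent02): §3 THE DESCENT LEMMA (pure integer arithmetic)

(lens-1 g59 NODE 20 HOME kernel K = HOME/decomp-schanuel-lens-1/g59/Cubic.lean eea76fbb…, 1125 l, imports tree …RootDecomp1KDescent06 ONLY = the port of node 19 (no Literature import, no fact def, no private, no set_option, no structure, no axiom / instance / sorry / native_decide); Probe / Ctrl0 / Ctrl + NODE-g59.md + SHA256SUMS; CLAIM L2763, writer g30 pre-kernel re-verification L2769, crit g10 EX-ANTE PRICE L2766 (ONE THEOREM ×1 for (A) descent lemma + (B) the uniform theorem thinFibreAt_CB over ℤ⁴ + (C) class/territory CJ j JOINTLY iff CHECKLIST K-g59 (1)–(10); RULE K-R51 pre-announced), census LIVENESS-v12/v13/v14 L2765/L2767/L2771 (node-20 rows; keys cub3 / frob / tors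 / jroot; of record L2766/L2768/L2772), NODE L2775, critic VERDICT L2777 (crit g10): CLEARED — THEOREM ×1 for (A) the descent lemma + (B) the uniform theorem thinFibreAt_CB over ℤ⁴ + (C) class/territory CJ j JOINTLY under RULE K-R50 (iii), CHECKLIST K-g59 (1)–(10) met, rung 0; LABEL OF RECORD: literature = VARIANT of a KNOWN TOOL (Chevalley–Weil through a rational-3-torsion μ₃-cover + Runge upstairs: Schaefer 1998 / Levin 2008 Thm 6 made explicit); RULE K-R51 FIXED (toolkit of record ∪= DESCENT IN GENERAL — every further descent-built member / family / torsion order ℓ / engine ×0-as-record; OPEN TERRITORY at m₀ = 2 := K-R49 territory ∧ NO ℚ-rational descent datum, k = 2 certificate = census LIVENESS keys j2rat none ∧ jroot(ℓ) none for ℓ ∈ {2,3,5,7,11} ∧ tors; standing witness W4 certified for ℓ ≤ 11; UNCONDITIONAL PART ∪= CB(ℤ⁴) at ThinFibreAt m₀ ≥ 2); TALLY lens-1 ×17 + THEOREM ×19; PORT GO exactly as census STAGING NOTES 10/10b L2774/L2776 (lens concurred L2775) with the edits (a) + (b) + (c) SANCTIONED. Port by census-1 gen 23 as `RootDecomp1KCubicDescent01–05`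 (`--supports stmt-Schanuel-33364`; no census credit): 01 = §0 helpers, §1 the family `CB h₁ h₀ l₁ l₀ = xPolyP 2 (cbC …)` (`cbH`, `cbL`, `cbC`, `bev_CB`), §2 the level equation in integers; 02 = §3 THE DESCENT LEMMA (pure ℤ-arithmetic, six named steps: `dvd_p_of_level`, `dvd_H_of_level`, `even_h_of_level`, `isCoprime_twist`, `eq_cube_of_coprime_cb`, `two_pow_dvd_add_of_cube_cb`; `descent_cb`); 03 = §4 THE ENGINE **`thinFibreAt_CB (h₁ h₀ l₁ l₀ : ℤ) (hm : 2 ≤ m₀) : ThinFibreAt m₀ (CB h₁ h₀ l₁ l₀)`** HYPOTHESIS-FREE, uniform over ℤ⁴ (the Runge function on the μ₃-cover is w + 2); 04 = §5 class data (`xDisc`, `CJ j := CB 0 5 5 (10 + 600 j)`, `cjQ`, `cjD`) and §6 the RABIN certificate mod 3 + Gauss: `Irreducible ((xDisc (CJ j)).map ℚ)` uniformly in j; 05 = §7 TERRITORY (section Territory): `CJ_territory`, named members CJ0 / CJ1. PORT EDITS: (a) 33 one-line docstrings quoting the signature on the undocumented decls (`cbC_two` / `cbC_one` / `cbC_zero`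 / `cbC_of_gt`, `aeval_cbH`, `aeval_cbL`, `monic_cbH`, `cbH_ne_zero`, `natDegree_cjD`, `coeff_cjD_six/five/four`, `leadingCoeff_cjD`, `ra2` … `re3`, `natDegree_cbH`, `natDegree_cbC_zero`, `natDegree_cbC_one_055`, `coeff_zero_cbC_two_055`, `monic_cjQ`, `natDegree_cjQ`, `cjQ_ne_zero`, `coeff_four_cjQ`, `cbC_two_055_ne_zero`, `bzB`, `bzM`, `bzW`, `thinFibreAt_two_CJ1`, `CJ0_territory`); (b) PRIVATISATION ×2 of the §0 one-liners that the head dry-run BOUNCED as dedup.landed twins of importable out-of-cone declarations — `isCoprime_num_den_cb` (≡ `Literature.NumberTheory.DiophantineApproximation.isCoprime_num_den`) and `odd_psNumer_cb` (≡ `RootDecomp1KCollarCell.odd_psNumer_two`, CollarCell02 = +53 modules) — with file-local private copies in 03 where §4's `thinFibreAt_CB` uses them; (c) K's import line moved ABOVE its 4-line copyright comment (the part-01 provenance module docstring must follow the import; comment kept verbatim); nothing else (no deletion, no replacement of a statement, no import added, no set_option; K's `@[simp]` kept); provenance doc blocks + continuation headers = K's own open-lines; statements and proofs VERBATIM. Rung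 0 — nothing here proves Schanuel, 33364, 33363, 31077 or ThinFibre 2; everything HYPOTHESIS-FREE.)
-/

noncomputable section

namespace Summit.Schanuel.Schanuel.Theorems.RootDecomp1KCubicDescent

open Polynomial LiouvilleNumber
open scoped Nat
open Summit.Schanuel.Schanuel.Theorems.RootDecomp1KTwoBaseCell (psNumer partialSum_eq_psNumer_div coprime_psNumer)
open Summit.Schanuel.Schanuel.Theorems.RootDecomp1KDegreeLadder
open Summit.Schanuel.Schanuel.Theorems.RootDecomp1KXLinear
open Summit.Schanuel.Schanuel.Theorems.RootDecomp1KXLinearII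
open Summit.Schanuel.Schanuel.Theorems.RootDecomp1KXTop
open Summit.Schanuel.Schanuel.Theorems.RootDecomp1KXAll
open Summit.Schanuel.Schanuel.Theorems.RootDecomp1KLevelFinite
open Summit.Schanuel.Schanuel.Theorems.RootDecomp1KThueMahler
open Summit.Schanuel.Schanuel.Theorems.RootDecomp1KParamThueMahler
open Summit.Schanuel.Schanuel.Theorems.RootDecomp1KLocalExponent
open Summit.Schanuel.Schanuel.Theorems.RootDecomp1KIntegrality (GaussAt gaussAt_xPolyP_iff)
open Summit.Schanuel.Schanuel.Theorems.RootDecomp1KSubspaceBranch (SepTopAt)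
open Summit.Schanuel.Schanuel.Theorems.RootDecomp1KRunge
open Summit.Schanuel.Schanuel.Theorems.RootDecomp1KDescent

/-! ### §3 THE DESCENT LEMMA (pure integer arithmetic)

Setting: `p` odd `> 0` (the numerator of `s_N`), `q = 8·2^k` (`= 2^{N!}`, `N! ≥ 3`), `r = u/d` in lowest
terms (`d > 0`), `H̃ = u² + d·v` (any `v`), `L̃ = m` (any `m`), and the level equation.  Notation of the
memo: `p = d·p'`, `H̃ = p'·h`, `h = 2h'`, `a' = (q/2)·h' − d³`, `b'' = h'·(q + m·p')`. -/

/-- STEP 1: `d ∣ p` (the level equation mod `d`: `d ∣ p²·F_Q` and `F_Q ≡ u⁴ (mod d)`; via the split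
`p = p₁g`, `d = d₁g`). -/
theorem dvd_p_of_level {p u d v m q : ℤ} (hp0 : 0 < p) (hud : IsCoprime u d)
    (hlev : p ^ 2 * ((u ^ 2 + d * v) ^ 2 + 4 * d ^ 3 * m) + p * q * d * (4 * d ^ 3 - m * (u ^ 2 + d * v)) -
      q ^ 2 * d ^ 2 * (u ^ 2 + d * v) = 0) : d ∣ p := by
  have hFQ : IsCoprime d ((u ^ 2 + d * v) ^ 2 + 4 * d ^ 3 * m) := by
    have e : (u ^ 2 + d * v) ^ 2 + 4 * d ^ 3 * m = u ^ 4 + d * (2 * u ^ 2 * v + d * v ^ 2 + 4 * d ^ 2 * m) := by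
      ring
    rw [e]
    exact (hud.symm.pow_right).add_mul_left_right _
  obtain ⟨g, p₁, d₁, hg, hcop, hp1, hd1⟩ := Int.exists_gcd_one' (Int.gcd_pos_of_ne_zero_left d hp0.ne')
  have hg0 : (g : ℤ) ≠ 0 := by exact_mod_cast hg.ne'
  have hcop' : IsCoprime d₁ p₁ := (Int.isCoprime_iff_gcd_eq_one.mpr hcop).symm
  -- the level equation divided by g²
  have hlev1 : p₁ ^ 2 * ((u ^ 2 + d * v) ^ 2 + 4 * d ^ 3 * m) + p₁ * q * d₁ * (4 * d ^ 3 - m * (u ^ 2 + d * v)) -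
      q ^ 2 * d₁ ^ 2 * (u ^ 2 + d * v) = 0 := by
    have e : (g : ℤ) ^ 2 * (p₁ ^ 2 * ((u ^ 2 + d * v) ^ 2 + 4 * d ^ 3 * m) +
        p₁ * q * d₁ * (4 * d ^ 3 - m * (u ^ 2 + d * v)) - q ^ 2 * d₁ ^ 2 * (u ^ 2 + d * v)) = 0 := by
      linear_combination hlev +
        (-(p + p₁ * g) * ((u ^ 2 + d * v) ^ 2 + 4 * d ^ 3 * m) - d * q * (4 * d ^ 3 - m * (u ^ 2 + d * v))) * hp1 +
        (-(p₁ * g * q * (4 * d ^ 3 - m * (u ^ 2 + d * v))) + (d + d₁ * g) * q ^ 2 * (u ^ 2 + d * v)) * hd1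
    rcases mul_eq_zero.mp e with h | h
    · exact absurd (pow_eq_zero_iff (n := 2) (by norm_num) |>.mp h) hg0
    · exact h
  have hd1FQ : d₁ ∣ p₁ ^ 2 * ((u ^ 2 + d * v) ^ 2 + 4 * d ^ 3 * m) :=
    ⟨-(p₁ * q * (4 * d ^ 3 - m * (u ^ 2 + d * v))) + q ^ 2 * d₁ * (u ^ 2 + d * v), by linear_combination hlev1⟩
  have hd1FQ' : d₁ ∣ (u ^ 2 + d * v) ^ 2 + 4 * d ^ 3 * m :=
    (hcop'.pow_right).dvd_of_dvd_mul_left hd1FQ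
  have hd1d : d₁ ∣ d := ⟨g, hd1⟩
  have hunit : IsUnit d₁ := (hFQ.of_isCoprime_of_dvd_left hd1d).isUnit_of_dvd' (dvd_refl d₁) hd1FQ'
  obtain ⟨w, hw⟩ := hunit.exists_right_inv
  refine ⟨p₁ * w, ?_⟩
  rw [hp1, hd1]
  linear_combination -(p₁ * (g : ℤ)) * hw

/-- STEP 2: with `p = d·p'`: `p' ∣ H̃` (the level equation divided by `d²`, read mod `p'`; `p'` odd is
coprime to `q = 8·2^k`). Returns the divided level equation as well. -/
theorem dvd_H_of_level {p' u d v m : ℤ} {k : ℕ} (hp' : Odd p') (hd0 : 0 < d)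
    (hlev : (d * p') ^ 2 * ((u ^ 2 + d * v) ^ 2 + 4 * d ^ 3 * m) +
      (d * p') * (8 * 2 ^ k) * d * (4 * d ^ 3 - m * (u ^ 2 + d * v)) -
      (8 * 2 ^ k) ^ 2 * d ^ 2 * (u ^ 2 + d * v) = 0) :
    p' ∣ u ^ 2 + d * v ∧
      p' ^ 2 * ((u ^ 2 + d * v) ^ 2 + 4 * d ^ 3 * m) + p' * (8 * 2 ^ k) * (4 * d ^ 3 - m * (u ^ 2 + d * v)) -
        (8 * 2 ^ k) ^ 2 * (u ^ 2 + d * v) = 0 := by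
  have hd : (d : ℤ) ≠ 0 := hd0.ne'
  have hlev2 : p' ^ 2 * ((u ^ 2 + d * v) ^ 2 + 4 * d ^ 3 * m) + p' * (8 * 2 ^ k) * (4 * d ^ 3 - m * (u ^ 2 + d * v)) -
      (8 * 2 ^ k) ^ 2 * (u ^ 2 + d * v) = 0 := by
    have e : d ^ 2 * (p' ^ 2 * ((u ^ 2 + d * v) ^ 2 + 4 * d ^ 3 * m) +
        p' * (8 * 2 ^ k) * (4 * d ^ 3 - m * (u ^ 2 + d * v)) - (8 * 2 ^ k) ^ 2 * (u ^ 2 + d * v)) = 0 := by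
      linear_combination hlev
    rcases mul_eq_zero.mp e with h | h
    · exact absurd (pow_eq_zero_iff (n := 2) (by norm_num) |>.mp h) hd
    · exact h
  refine ⟨?_, hlev2⟩
  have h2 : IsCoprime p' ((8 * 2 ^ k) ^ 2) := by
    have h82 : (8 * 2 ^ k : ℤ) = 2 ^ (k + 3) := by ring
    rw [h82, ← pow_mul]
    exact ((isCoprime_two_of_odd_cb hp').symm).pow_right
  have hdvd : p' ∣ (8 * 2 ^ k) ^ 2 * (u ^ 2 + d * v) :=
    ⟨p' * ((u ^ 2 + d * v) ^ 2 + 4 * d ^ 3 * m) + (8 * 2 ^ k) * (4 * d ^ 3 - m * (u ^ 2 + d * v)),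
      by linear_combination -hlev2⟩
  exact h2.dvd_of_dvd_mul_left hdvd

/-- STEP 3 (parity): with `H̃ = p'·h` the divided level equation reads
`p'·(p'²h² + 4d³m) + q·(4d³ − m·p'·h) − q²·h = 0`; `q` even and `p'` odd force `h` even. -/
theorem even_h_of_level {p' d m h : ℤ} {k : ℕ} (hp' : Odd p')
    (hE3 : p' * (p' ^ 2 * h ^ 2 + 4 * d ^ 3 * m) + (8 * 2 ^ k) * (4 * d ^ 3 - m * p' * h) - (8 * 2 ^ k) ^ 2 * h = 0) :
    Even h := by
  by_contra hodd
  rw [Int.not_even_iff_odd] at hodd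
  have h1 : Odd (p' ^ 3 * h ^ 2) := (hp'.pow).mul hodd.pow
  have h2 : Even (p' ^ 3 * h ^ 2) :=
    ⟨-(2 * d ^ 3 * m * p') - (4 * 2 ^ k) * (4 * d ^ 3 - m * p' * h) + (32 * (2 ^ k) ^ 2) * h, by
      linear_combination hE3⟩
  exact (Int.not_odd_iff_even.mpr h2) h1

/-- STEP 4 (twist-killing): `a' := (q/2)·h' − d³` and `b'' := h'·(q + m·p')` are COPRIME when `d` is odd
and `u ⊥ d`, `H̃ = u² + d·v = 2p'h'`: an odd prime dividing both divides `p'h'` (from `a'b'' = (p'h')³`),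
hence `H̃`, and `2b'' − 4a' = m·H̃ + 4d³`, hence `4d³`, hence `d`, hence `u²` — impossible; and `2 ∤ a'`. -/
theorem isCoprime_twist {p' u d v m h' : ℤ} {k : ℕ} (hd : Odd d) (hud : IsCoprime u d)
    (hH : u ^ 2 + d * v = 2 * (p' * h'))
    (hcube : (4 * 2 ^ k * h' - d ^ 3) * (h' * (8 * 2 ^ k + m * p')) = (p' * h') ^ 3) :
    IsCoprime (4 * 2 ^ k * h' - d ^ 3) (h' * (8 * 2 ^ k + m * p')) := by
  have hodd : Odd (4 * 2 ^ k * h' - d ^ 3) := by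
    refine Even.sub_odd ⟨2 * 2 ^ k * h', by ring⟩ hd.pow
  rw [Int.isCoprime_iff_gcd_eq_one]
  by_contra hg
  obtain ⟨ℓ, hℓ, hℓg⟩ := Nat.exists_prime_and_dvd hg
  have hℓZ : Prime (ℓ : ℤ) := Nat.prime_iff_prime_int.mp hℓ
  have hℓa : (ℓ : ℤ) ∣ 4 * 2 ^ k * h' - d ^ 3 :=
    (Int.natCast_dvd_natCast.mpr hℓg).trans (Int.gcd_dvd_left _ _)
  have hℓb : (ℓ : ℤ) ∣ h' * (8 * 2 ^ k + m * p') :=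
    (Int.natCast_dvd_natCast.mpr hℓg).trans (Int.gcd_dvd_right _ _)
  -- ℓ is odd
  have hℓ2 : ¬ (ℓ : ℤ) ∣ 2 := by
    intro h2
    have h2' : ℓ ∣ 2 := Int.natCast_dvd_natCast.mp h2
    have hℓeq : ℓ = 2 := (Nat.prime_dvd_prime_iff_eq hℓ Nat.prime_two).mp h2'
    subst hℓeq
    have : ¬ (2 : ℤ) ∣ 4 * 2 ^ k * h' - d ^ 3 := by
      rw [← even_iff_two_dvd, Int.not_even_iff_odd]; exact hodd
    exact this (by exact_mod_cast hℓa)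
  -- ℓ ∣ p'h'
  have hℓph : (ℓ : ℤ) ∣ p' * h' := hℓZ.dvd_of_dvd_pow (hcube ▸ dvd_mul_of_dvd_left hℓa _)
  -- ℓ ∣ H̃ and ℓ ∣ m·H̃ + 4d³
  have hℓH : (ℓ : ℤ) ∣ u ^ 2 + d * v := hH ▸ dvd_mul_of_dvd_right hℓph 2
  have hℓG : (ℓ : ℤ) ∣ m * (u ^ 2 + d * v) + 4 * d ^ 3 := by
    have e : m * (u ^ 2 + d * v) + 4 * d ^ 3 = 2 * (h' * (8 * 2 ^ k + m * p')) - 4 * (4 * 2 ^ k * h' - d ^ 3) := by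
      rw [hH]; ring
    rw [e]
    exact dvd_sub (dvd_mul_of_dvd_right hℓb 2) (dvd_mul_of_dvd_right hℓa 4)
  have hℓ4d : (ℓ : ℤ) ∣ 4 * d ^ 3 := by
    have := dvd_sub hℓG (dvd_mul_of_dvd_right hℓH m)
    have e : m * (u ^ 2 + d * v) + 4 * d ^ 3 - m * (u ^ 2 + d * v) = 4 * d ^ 3 := by ring
    rwa [e] at this
  have hℓd : (ℓ : ℤ) ∣ d := by
    rcases hℓZ.dvd_or_dvd hℓ4d with h4 | hd3
    · exfalso
      have : (ℓ : ℤ) ∣ 2 ^ 2 := by norm_num; exact h4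
      exact hℓ2 (hℓZ.dvd_of_dvd_pow this)
    · exact hℓZ.dvd_of_dvd_pow hd3
  have hℓu : (ℓ : ℤ) ∣ u := by
    have hu2 : (ℓ : ℤ) ∣ u ^ 2 := by
      have := dvd_sub hℓH (dvd_mul_of_dvd_left hℓd v)
      have e : u ^ 2 + d * v - d * v = u ^ 2 := by ring
      rwa [e] at this
    exact hℓZ.dvd_of_dvd_pow hu2
  exact hℓZ.not_unit (hud.isUnit_of_dvd' hℓu hℓd)

/-- STEP 5 (CUBE EXTRACTION): coprime integers whose product is a cube are themselves cubes (Mathlib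
`Int.eq_pow_of_mul_eq_pow_odd_left` at the odd exponent `3`; signs are absorbed since `(−1)³ = −1`). -/
theorem eq_cube_of_coprime_cb {a b c : ℤ} (hab : IsCoprime a b) (h : a * b = c ^ 3) : ∃ e : ℤ, a = e ^ 3 :=
  Int.eq_pow_of_mul_eq_pow_odd_left hab (by decide) h

/-- STEP 6 (THE 2-ADIC DIGITS): `e³ = 4·2^k·h' − d³` with `d` odd forces `e` odd and `2^{k+2} ∣ e + d`
(`e³ + d³ = (e + d)·(e² − ed + d²)` and the second factor is odd). -/
theorem two_pow_dvd_add_of_cube_cb {e d h' : ℤ} {k : ℕ} (hd : Odd d) (he : e ^ 3 = 4 * 2 ^ k * h' - d ^ 3) :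
    (2 : ℤ) ^ (k + 2) ∣ e + d := by
  have hodda : Odd (4 * 2 ^ k * h' - d ^ 3) := Even.sub_odd ⟨2 * 2 ^ k * h', by ring⟩ hd.pow
  have he_odd : Odd e := by
    by_contra hev
    have h3 : Even (e ^ 3) := (Int.even_pow' (by norm_num)).mpr (Int.not_odd_iff_even.mp hev)
    rw [he] at h3
    exact (Int.not_even_iff_odd.mpr hodda) h3
  have hfac : (e + d) * (e ^ 2 - e * d + d ^ 2) = 2 ^ (k + 2) * h' := by linear_combination he
  have hodd2 : Odd (e ^ 2 - e * d + d ^ 2) := (Odd.sub_odd he_odd.pow (he_odd.mul hd)).add_odd hd.pow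
  exact ((isCoprime_two_of_odd_cb hodd2).pow_left).dvd_of_dvd_mul_right ⟨h', hfac⟩

/-- **THE DESCENT LEMMA.**  At a level point (`p` odd `> 0`, `q = 8·2^k`, `r = u/d` reduced, `d > 0`,
`H̃ = u² + d·v`, `L̃ = m`, the level equation) there is an integer `e` — `e/d` is the rational cube root
`w/2` of `H(r)/(4s_N) − 1` — with `4p·e³ = q·d·H̃ − 4p·d³` and `2^{k+2} ∣ e + d`. -/
theorem descent_cb {p u d v m : ℤ} {k : ℕ} (hp : Odd p) (hp0 : 0 < p) (hd0 : 0 < d) (hud : IsCoprime u d)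
    (hlev : p ^ 2 * ((u ^ 2 + d * v) ^ 2 + 4 * d ^ 3 * m) + p * (8 * 2 ^ k) * d * (4 * d ^ 3 - m * (u ^ 2 + d * v)) -
      (8 * 2 ^ k) ^ 2 * d ^ 2 * (u ^ 2 + d * v) = 0) :
    ∃ e : ℤ, (2 : ℤ) ^ (k + 2) ∣ e + d ∧ 4 * p * e ^ 3 = (8 * 2 ^ k) * d * (u ^ 2 + d * v) - 4 * p * d ^ 3 := by
  -- Step 1: d ∣ p, p = d·p'
  obtain ⟨p', rfl⟩ := dvd_p_of_level hp0 hud hlev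
  have hp' : Odd p' := Int.Odd.of_mul_right hp
  have hd : Odd d := Int.Odd.of_mul_left hp
  -- Step 2: p' ∣ H̃ = p'·h
  obtain ⟨⟨h, hh⟩, hlev2⟩ := dvd_H_of_level hp' hd0 hlev
  have hp'0 : p' ≠ 0 := by rintro rfl; simp at hp0
  -- the divided level equation E3
  have hE3 : p' * (p' ^ 2 * h ^ 2 + 4 * d ^ 3 * m) + (8 * 2 ^ k) * (4 * d ^ 3 - m * p' * h) - (8 * 2 ^ k) ^ 2 * h = 0 := by
    have e : p' * (p' * (p' ^ 2 * h ^ 2 + 4 * d ^ 3 * m) + (8 * 2 ^ k) * (4 * d ^ 3 - m * p' * h) -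
        (8 * 2 ^ k) ^ 2 * h) = 0 := by
      rw [hh] at hlev2; linear_combination hlev2
    rcases mul_eq_zero.mp e with h0 | h0
    · exact absurd h0 hp'0
    · exact h0
  -- Step 3: h = 2h'
  obtain ⟨h', rfl⟩ := (even_iff_two_dvd.mp (even_h_of_level hp' hE3))
  -- the cube relation a'·b'' = (p'h')³  (= −h'·E3 / 4)
  have hcube : (4 * 2 ^ k * h' - d ^ 3) * (h' * (8 * 2 ^ k + m * p')) = (p' * h') ^ 3 := by
    have e : 4 * ((4 * 2 ^ k * h' - d ^ 3) * (h' * (8 * 2 ^ k + m * p')) - (p' * h') ^ 3) = 0 := by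
      linear_combination (-h') * hE3
    linarith
  -- Step 4: a' ⊥ b''
  have hH : u ^ 2 + d * v = 2 * (p' * h') := by rw [hh]; ring
  have hcop := isCoprime_twist (k := k) hd hud hH hcube
  -- Step 5: a' = e³;  Step 6: 2^{k+2} ∣ e + d
  obtain ⟨e, he⟩ := eq_cube_of_coprime_cb hcop hcube
  refine ⟨e, two_pow_dvd_add_of_cube_cb hd he.symm, ?_⟩
  rw [hH]
  linear_combination (4 * (d * p')) * he.symm

end Summit.Schanuel.Schanuel.Theorems.RootDecomp1KCubicDescent

end
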